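import Summits.BirchSwinnertonDyer.BirchSwinnertonDyer.Theorems.GoldfeldAllTwistsTwoConverseTwinEvenTwistDescent
import Summits.BirchSwinnertonDyer.BirchSwinnertonDyer.Theorems.GoldfeldAllTwistsTwoConverseTwinAdditiveTwoAdicPOne
import Summits.BirchSwinnertonDyer.BirchSwinnertonDyer.Theorems.GoldfeldAllTwistsTwoConverseTwinSplitSymbolAlphaRoots
import Summits.BirchSwinnertonDyer.BirchSwinnertonDyer.Theorems.GoldfeldAllTwistsTwoConverseTwinAdditiveTwoPrimesTwistSelmer
import HarnessLib

set_option linter.dupNamespace false -- namespace `…BirchSwinnertonDyer.BirchSwinnertonDyer…` is the cell's (D-0017 nested layout)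
set_option autoImplicit false

/-!
# Cell C7A partner `49a1^{(2p)}` at `p ≡ 1 (mod 8)`, type α, file D1-even: the `2`-isogeny descent — `#S ≤ 2`, `#S′ ≤ 2`, rank `0`, `Ш[2] = 0`,
# `corank₂ Sel_{2^∞} = 0` — LINE C3's file 1b twinned (FACT-FREE)

Cell `bsd-goldfeld`, seat `bsd-goldfeld-s1p-c3x` (gen 13); planner RULING (ccclx) «OBJECT C7A BY THE χ_Z CHANNEL», tranche T3, file D1-even (memo
`HOME/C7A-CHIZ-CHANNEL.md` §3: the input of the χ_q package valuation `ord₂ L^{alg}(49a1^{(2p)}) = 3`, file D2-even). `--supports stmt-BirchSwinnertonDyer-20044`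
as a HELPER. Theses-free; theorems only; no definition, no fact binder, no `sorry`. FRONTIER-grade: a twist-density-ZERO sub-family; never distance-to-summit.

OBJECT. For a prime `p ≡ 1 (mod 8)` with `(−7/p) = +1` and `−7` NOT a fourth power mod `p` (type α) the two-torsion model `E_{2p} : y² = x³ + 42p·x² + 448p²·x`
has `S(42p, 448p²) ⊆ {1, 7}` and `S′ = S(−84p, −28p²) ⊆ {1, −7}` (kit j317613: equality on 47/47 C7A rows), hence `rank = 0`, `Ш[2] = 0`, `corank 0` for every
model of `49a1^{(2p)}` — the (M7) flip of C7 (β: `p ∈ S′`, `Ш[2] ≠ 0`) is ABSENT on the α sibling.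
KILLS vs LINE C3 (`p ≡ 5 (8)`): `S`: `2, 14` and `2p, 14p` at the prime `2` (D0-(L2): `u = p` a `ℤ₂`-square; C3 killed `2, 14` at `p` by `(2/p) = −1` and `p, 2p, 7p`
at `2`), `p, 7p` at `p` by the type-α root tests `Q₃ = 448X⁴ + 42X² + 1`, `Q₄ = 64X⁴ + 42X² + 7` (D0-(Lα′)); `S′`: the eight `7`-adic kills VERBATIM,
`2, −14, 2p, −14p` at `2`, `p, −7p` at `p` by `Q₁, Q₂`.
HONEST FRAMING: Selmer counts for one partner twist; items 19140 / 20044 unchanged; BSD is not proved by any of this.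

References: [SilvermanAEC2009] Thm. X.4.2(a), Prop. X.4.9, Example X.4.10; [Zywina2025] Lemma 3.1; [CoatesLiTianZhai2015] §5.
-/

noncomputable section

open scoped Classical

open WeierstrassCurve Literature.NumberTheory.EllipticCurves
open Literature.NumberTheory.EllipticCurves.Zywina2025 (isSquare_zmod_of_isSoluble_padic)

namespace Summit.BirchSwinnertonDyer.BirchSwinnertonDyer.Theorems.GoldfeldGoodTwists

/-! ## §1 Four more `2`-adic class kills at `p ≡ 1 (mod 8)` (common factor `p ↦ 1`) -/

section TwoAdicEven
variable {u : ℤ} {p : ℕ}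

/-- **Class `2u ∈ S(42u, 448u²)` dies at `2`** (`8 ∣ u − 1`): numeric `(42; 2, 224)`. [cite: SilvermanAEC2009, Prop. X.4.9] -/
theorem not_isSoluble_two_class_twoU_even (h8 : (8 : ℤ) ∣ u - 1) {a d d' : ℤ} (ha : a = 42 * u) (hd : d = 2 * u) (hd' : d' = 224 * u) :
    ¬ ((twoIsogenyQuartic a d d').map (Int.castRingHom ℚ_[2])).IsSoluble := fun h ↦ by
  have h1 := isSoluble_two_of_common_factor (n := u) (n₀ := 1) (by simpa using h8) (a₀ := 42) (d₀ := 2) (e₀ := 224)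
    (by rw [ha]; ring) (by rw [hd]; ring) (by rw [hd']; ring) h
  norm_num at h1
  exact not_isSoluble_two_numeric_two_even_pOneAlpha h1

/-- **Class `14u ∈ S(42u, 448u²)` dies at `2`** (`8 ∣ u − 1`): numeric `(42; 14, 32)`. [cite: SilvermanAEC2009, Prop. X.4.9] -/
theorem not_isSoluble_two_class_fourteenU_even (h8 : (8 : ℤ) ∣ u - 1) {a d d' : ℤ} (ha : a = 42 * u) (hd : d = 14 * u) (hd' : d' = 32 * u) :
    ¬ ((twoIsogenyQuartic a d d').map (Int.castRingHom ℚ_[2])).IsSoluble := fun h ↦ by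
  have h1 := isSoluble_two_of_common_factor (n := u) (n₀ := 1) (by simpa using h8) (a₀ := 42) (d₀ := 14) (e₀ := 32)
    (by rw [ha]; ring) (by rw [hd]; ring) (by rw [hd']; ring) h
  norm_num at h1
  exact not_isSoluble_two_numeric_fourteen_even_pOneAlpha h1

/-- **Class `2p ∈ S′(49a1^{(2p)}) = S(−84p, −28p²)` dies at `2`** (`p ≡ 1 (8)`): `p ↦ 1` gives F9a's `(−84; 2, −14)`. [cite: SilvermanAEC2009, Prop. X.4.9] -/
theorem not_isSoluble_two_dualPos_twoP_pOne (hp8 : p % 8 = 1) {a d d' : ℤ} (ha : a = -84 * (p : ℤ)) (hd : d = 2 * (p : ℤ))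
    (hd' : d' = -14 * (p : ℤ)) : ¬ ((twoIsogenyQuartic a d d').map (Int.castRingHom ℚ_[2])).IsSoluble := fun h ↦ by
  have h1 := isSoluble_two_of_common_factor (n := p) (n₀ := 1) (by omega) (a₀ := -84) (d₀ := 2) (e₀ := -14)
    (by rw [ha]; ring) (by rw [hd]; ring) (by rw [hd']; ring) h
  norm_num at h1
  exact not_isSoluble_two_normalised_pOne h1

/-- **Class `−14p ∈ S′(49a1^{(2p)})` dies at `2`** (`p ≡ 1 (8)`). [cite: SilvermanAEC2009, Prop. X.4.9] -/
theorem not_isSoluble_two_dualPos_negFourteenP_pOne (hp8 : p % 8 = 1) {a d d' : ℤ} (ha : a = -84 * (p : ℤ)) (hd : d = -14 * (p : ℤ))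
    (hd' : d' = 2 * (p : ℤ)) : ¬ ((twoIsogenyQuartic a d d').map (Int.castRingHom ℚ_[2])).IsSoluble := fun h ↦ by
  have h1 := isSoluble_two_of_common_factor (n := p) (n₀ := 1) (by omega) (a₀ := -84) (d₀ := -14) (e₀ := 2)
    (by rw [ha]; ring) (by rw [hd]; ring) (by rw [hd']; ring) h
  norm_num at h1
  rw [isSoluble_map_twoIsogenyQuartic_comm] at h1
  exact not_isSoluble_two_normalised_pOne h1

end TwoAdicEven

/-! ## §2 The Selmer orders at a type-α prime `p ≡ 1 (mod 8)` -/

/-- **`#S(42p, 448p²) ≤ 2`** for a type-α prime `p ≡ 1 (mod 8)` with `(−7/p) = +1`: `S ⊆ {1, 7}` (negatives die at `∞`, `2, 14` and `2p, 14p`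
at the prime `2`, `p, 7p` at `p` by the root tests `Q₃, Q₄`). [cite: SilvermanAEC2009, Prop. X.4.9 and Example X.4.10] -/
theorem card_twoIsogenySelmerGroup_twoPosTwist_le_pOneAlpha {p : ℕ} [Fact p.Prime] (hp8 : p % 8 = 1)
    (hp7 : legendreSym p (-7) = 1) (hα : ¬ ∃ x : ZMod p, x ^ 4 = -7) :
    (twoIsogenySelmerGroup (42 * p) (448 * p ^ 2)).card ≤ 2 := by
  have hp : p.Prime := Fact.out
  have hpp : Prime (p : ℤ) := Nat.prime_iff_prime_int.mp hp
  have hp0 : (p : ℤ) ≠ 0 := by exact_mod_cast hp.ne_zero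
  have hppos : (0 : ℤ) < p := by exact_mod_cast hp.pos
  have hb : (448 * p ^ 2 : ℤ) ≠ 0 := by positivity
  have h8 : (8 : ℤ) ∣ (p : ℤ) - 1 := by
    have : (8 : ℤ) ∣ ((p : ℕ) : ℤ) - 1 := by omega
    exact this
  have h448p : ((448 : ℤ) : ZMod p) ≠ 0 := by
    have hp2 : p ≠ 2 := by rintro rfl; norm_num at hp8
    have hp7' : p ≠ 7 := by rintro rfl; norm_num at hp8
    have h : ¬ p ∣ 2 ^ 6 * 7 ^ 1 := fun h ↦ by
      rcases (Nat.Prime.dvd_mul hp).mp h with h | h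
      · exact hp2 ((Nat.prime_dvd_prime_iff_eq hp Nat.prime_two).mp (hp.dvd_of_dvd_pow h))
      · exact hp7' ((Nat.prime_dvd_prime_iff_eq hp (by norm_num)).mp (by simpa using h))
    intro h0; apply h
    have : ((448 : ℕ) : ZMod p) = 0 := by exact_mod_cast h0
    exact (ZMod.natCast_eq_zero_iff _ _).mp this
  have h64p : ((64 : ℤ) : ZMod p) ≠ 0 := by
    intro h0; apply h448p
    rw [show ((448 : ℤ) : ZMod p) = ((64 : ℤ) : ZMod p) * 7 by push_cast; norm_num, h0, zero_mul]
  have hsub : twoIsogenySelmerGroup (42 * p) (448 * p ^ 2) ⊆ ({1, 7} : Finset ℤ) := by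
    intro d hd
    rw [mem_twoIsogenySelmerGroup_iff hb] at hd
    obtain ⟨hsqf, ⟨d', hdd'⟩, hloc⟩ := hd
    have hd'eq : (448 * p ^ 2 : ℤ) / d = d' := by
      rw [hdd', Int.mul_ediv_cancel_left _ hsqf.ne_zero]
    rw [hd'eq] at hloc
    obtain ⟨hreal, hpadic⟩ := hloc
    have hdpos : 0 < d := by
      rcases lt_or_gt_of_ne hsqf.ne_zero with hneg | hpos
      · exfalso
        refine not_isSoluble_real_twoIsogenyQuartic_of_neg_of_sq_lt hneg ?_ hreal
        rw [← hdd']; nlinarith [sq_nonneg (p : ℤ)]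
      · exact hpos
    have hne2 : d ≠ 2 := by
      rintro rfl
      exact not_isSoluble_two_class_two_even (u := (p : ℤ)) h8 (by ring) rfl (show d' = 224 * (p : ℤ) ^ 2 by linarith) (hpadic 2)
    have hne14 : d ≠ 14 := by
      rintro rfl
      exact not_isSoluble_two_class_fourteen_even (u := (p : ℤ)) h8 (by ring) rfl (show d' = 32 * (p : ℤ) ^ 2 by linarith) (hpadic 2)
    have h0 : d ∣ 448 * (p : ℤ) ^ 2 := ⟨d', hdd'⟩
    have h1 : d ∣ (14 * (p : ℤ)) ^ 6 := h0.trans ⟨16807 * (p : ℤ) ^ 4, by ring⟩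
    have h14p : d ∣ 14 * (p : ℤ) := (hsqf.dvd_pow_iff_dvd (by norm_num)).mp h1
    simp only [Finset.mem_insert, Finset.mem_singleton]
    by_cases hpd : (p : ℤ) ∣ d
    · obtain ⟨e, rfl⟩ := hpd
      have he14 : e ∣ 14 := by
        have : (p : ℤ) * e ∣ (p : ℤ) * 14 := by rw [mul_comm (p : ℤ) 14]; exact h14p
        exact (mul_dvd_mul_iff_left hp0).mp this
      have hd'e : e * d' = 448 * p := mul_left_cancel₀ hp0 (by linear_combination -hdd')
      have hepos : 0 < e := pos_of_mul_pos_right hdpos hppos.le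
      have hele : e ≤ 14 := Int.le_of_dvd (by norm_num) he14
      -- at `p` (type-α root tests `Q₃`, `Q₄`): `e = 1, 7`; at `2`: `e = 2, 14`
      have hne1 : e ≠ 1 := by
        rintro rfl
        refine not_isSoluble_padic_of_prime_dvd_coeffs_of_roots (p := p) (c := 42) (e := 1) (e' := 448) (by ring) (by ring)
          (show d' = (p : ℤ) * 448 by linarith) h448p (fun T hT ↦ ?_) (hpadic p)
        rintro ⟨X, rfl⟩
        apply (rootfree_negSeven_type_of_alpha hp8 hα X).1
        have e1 : ((448 : ℤ) : ZMod p) * (X * X) ^ 2 + ((42 : ℤ) : ZMod p) * (X * X) + ((1 : ℤ) : ZMod p) =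
            448 * X ^ 4 + 42 * X ^ 2 + 1 := by push_cast; ring
        rwa [e1] at hT
      have hne2' : e ≠ 2 := by
        rintro rfl
        exact not_isSoluble_two_class_twoU_even (u := (p : ℤ)) h8 (by ring) (by ring) (show d' = 224 * (p : ℤ) by linarith) (hpadic 2)
      have hne7 : e ≠ 7 := by
        rintro rfl
        refine not_isSoluble_padic_of_prime_dvd_coeffs_of_roots (p := p) (c := 42) (e := 7) (e' := 64) (by ring) (by ring)
          (show d' = (p : ℤ) * 64 by linarith) h64p (fun T hT ↦ ?_) (hpadic p)
        rintro ⟨X, rfl⟩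
        apply (rootfree_negSeven_type_of_alpha hp8 hα X).2.1
        have e1 : ((64 : ℤ) : ZMod p) * (X * X) ^ 2 + ((42 : ℤ) : ZMod p) * (X * X) + ((7 : ℤ) : ZMod p) =
            64 * X ^ 4 + 42 * X ^ 2 + 7 := by push_cast; ring
        rwa [e1] at hT
      have hne14' : e ≠ 14 := by
        rintro rfl
        exact not_isSoluble_two_class_fourteenU_even (u := (p : ℤ)) h8 (by ring) (by ring) (show d' = 32 * (p : ℤ) by linarith) (hpadic 2)
      exfalso
      obtain ⟨k, hk⟩ := he14
      interval_cases e <;> omega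
    · have hcop : IsCoprime d (p : ℤ) := ((hpp.irreducible.coprime_iff_not_dvd).mpr hpd).symm
      have hd14 : d ∣ 14 := hcop.dvd_of_dvd_mul_right h14p
      have hle : d ≤ 14 := Int.le_of_dvd (by norm_num) hd14
      obtain ⟨k, hk⟩ := hd14
      interval_cases d <;> first | (exfalso; omega) | simp
  exact (Finset.card_le_card hsub).trans Finset.card_le_two

/-- **`#S'(42p, 448p²) = #S(−84p, −28p²) ≤ 2`** for a type-α prime `p ≡ 1 (mod 8)` with `(−7/p) = +1`: `S' ⊆ {1, −7}`
(`−1, −2, −p, −2p, 7, 14, 7p, 14p` die at `7`; `2, −14, 2p, −14p` at the prime `2`; `p, −7p` at `p` by the root tests `Q₁, Q₂`).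
[cite: SilvermanAEC2009, Prop. X.4.9] [cite: Zywina2025, Lemma 3.1 (proof)] -/
theorem card_twoIsogenySelmerGroup'_twoPosTwist_le_pOneAlpha {p : ℕ} [Fact p.Prime] (hp8 : p % 8 = 1)
    (hp7 : legendreSym p (-7) = 1) (hα : ¬ ∃ x : ZMod p, x ^ 4 = -7) :
    (twoIsogenySelmerGroup' (42 * p) (448 * p ^ 2)).card ≤ 2 := by
  have hp : p.Prime := Fact.out
  haveI : Fact (Nat.Prime 7) := ⟨by norm_num⟩
  have hpp : Prime (p : ℤ) := Nat.prime_iff_prime_int.mp hp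
  have hp0 : (p : ℤ) ≠ 0 := by exact_mod_cast hp.ne_zero
  have hp7' : p ≠ 7 := by rintro rfl; norm_num at hp8
  obtain ⟨hp07, hpsq⟩ := p_square_mod_seven (by omega) hp7 hp7'
  have htab := zmod_seven_table' (p : ZMod 7) hpsq
  have hp07Z : ((p : ℤ) : ZMod 7) ≠ 0 := by exact_mod_cast hp07
  have h8 : (8 : ℤ) ∣ (p : ℤ) - 1 := by
    have : (8 : ℤ) ∣ ((p : ℕ) : ℤ) - 1 := by omega
    exact this
  have hm28p : ((-28 : ℤ) : ZMod p) ≠ 0 := by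
    push_cast; refine neg_ne_zero.mpr ?_
    have : ((28 : ℕ) : ZMod p) ≠ 0 := by
      rw [Ne, ZMod.natCast_eq_zero_iff]
      intro h
      have hp2 : p ≠ 2 := by rintro rfl; norm_num at hp8
      rcases (Nat.Prime.dvd_mul hp).mp (show p ∣ 4 * 7 by simpa using h) with h | h
      · exact hp2 ((Nat.prime_dvd_prime_iff_eq hp Nat.prime_two).mp (hp.dvd_of_dvd_pow (show p ∣ 2 ^ 2 by simpa using h)))
      · exact hp7' ((Nat.prime_dvd_prime_iff_eq hp (by norm_num)).mp h)
    exact_mod_cast this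
  have h4p : ((4 : ℤ) : ZMod p) ≠ 0 := by
    intro h0; apply hm28p
    rw [show ((-28 : ℤ) : ZMod p) = ((4 : ℤ) : ZMod p) * (-7) by push_cast; norm_num, h0, zero_mul]
  have hA : (-2 * (42 * p : ℤ)) = -84 * p := by ring
  have hB : ((42 * p : ℤ) ^ 2 - 4 * (448 * p ^ 2)) = -28 * p ^ 2 := by ring
  have hb : (-28 * p ^ 2 : ℤ) ≠ 0 := mul_ne_zero (by norm_num) (pow_ne_zero 2 hp0)
  have hsub : twoIsogenySelmerGroup' (42 * p) (448 * p ^ 2) ⊆ ({1, -7} : Finset ℤ) := by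
    intro d hd
    rw [twoIsogenySelmerGroup'_eq, hA, hB, mem_twoIsogenySelmerGroup_iff hb] at hd
    obtain ⟨hsqf, ⟨d', hdd'⟩, hloc⟩ := hd
    have hd'eq : (-28 * p ^ 2 : ℤ) / d = d' := by
      rw [hdd', Int.mul_ediv_cancel_left _ hsqf.ne_zero]
    rw [hd'eq] at hloc
    obtain ⟨-, hpadic⟩ := hloc
    have hdisc : ∀ x y : ℤ, x * y = -28 * (p : ℤ) ^ 2 →
        (7 : ℤ) ∣ (-84 * (p : ℤ)) ^ 2 - 4 * x * y ∧ ¬ (7 : ℤ) ^ 2 ∣ (-84 * (p : ℤ)) ^ 2 - 4 * x * y := by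
      intro x y hxy
      have e1 : (-84 * (p : ℤ)) ^ 2 - 4 * x * y = 7168 * (p : ℤ) ^ 2 := by rw [mul_assoc, hxy]; ring
      rw [e1]
      refine ⟨⟨1024 * (p : ℤ) ^ 2, by ring⟩, fun h => ?_⟩
      have h7p : Prime (7 : ℤ) := Int.prime_iff_natAbs_prime.mpr (by norm_num)
      have h49 : (7 : ℤ) ^ 2 ∣ 7 * (1024 * (p : ℤ) ^ 2) := by rw [show (7168 : ℤ) * (p : ℤ) ^ 2 = 7 * (1024 * p ^ 2) by ring] at h; exact h
      have h7 : (7 : ℤ) ∣ 1024 * (p : ℤ) ^ 2 := by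
        rw [pow_two] at h49
        exact (mul_dvd_mul_iff_left (by norm_num : (7 : ℤ) ≠ 0)).mp h49
      rcases h7p.dvd_or_dvd h7 with h5 | h5
      · norm_num at h5
      · exact hp07Z ((ZMod.intCast_zmod_eq_zero_iff_dvd _ 7).mpr (h7p.dvd_of_dvd_pow h5))
    have h7p : Prime (7 : ℤ) := Int.prime_iff_natAbs_prime.mpr (by norm_num)
    have hnd7 : ∀ k : ℤ, ¬ (7 : ℤ) ∣ k → ∀ n : ℕ, ¬ (7 : ℤ) ∣ k * (p : ℤ) ^ n := by
      intro k hk n h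
      rcases h7p.dvd_or_dvd h with h5 | h5
      · exact hk h5
      · exact hp07Z ((ZMod.intCast_zmod_eq_zero_iff_dvd _ 7).mpr (h7p.dvd_of_dvd_pow h5))
    have kill : ∀ x y : ℤ, x * y = -28 * (p : ℤ) ^ 2 → ¬ (7 : ℤ) ∣ x →
        ((twoIsogenyQuartic (-84 * p) x y).map (Int.castRingHom ℚ_[7])).IsSoluble →
        ∃ r : ZMod 7, ((x : ℤ) : ZMod 7) = r * r := by
      intro x y hxy hx hsol
      obtain ⟨hB1, hB2⟩ := hdisc x y hxy
      exact (isSquare_zmod_of_isSoluble_padic (p := 7) (by norm_num) hx hB1 hB2 hsol).2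
    have kill' : ∀ x y : ℤ, x * y = -28 * (p : ℤ) ^ 2 → ¬ (7 : ℤ) ∣ y →
        ((twoIsogenyQuartic (-84 * p) x y).map (Int.castRingHom ℚ_[7])).IsSoluble →
        ∃ r : ZMod 7, ((y : ℤ) : ZMod 7) = r * r := by
      intro x y hxy hy hsol
      exact kill y x (by rw [mul_comm]; exact hxy) hy
        ((isSoluble_map_twoIsogenyQuartic_comm _ _ _ _).mp hsol)
    have h0 : d ∣ -28 * (p : ℤ) ^ 2 := ⟨d', hdd'⟩
    have h1 : d ∣ (14 * (p : ℤ)) ^ 2 := h0.trans ⟨-7, by ring⟩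
    have h14p : d ∣ 14 * (p : ℤ) := (hsqf.dvd_pow_iff_dvd (by norm_num)).mp h1
    simp only [Finset.mem_insert, Finset.mem_singleton]
    by_cases hpd : (p : ℤ) ∣ d
    · obtain ⟨e, rfl⟩ := hpd
      have he14 : e ∣ 14 := by
        have : (p : ℤ) * e ∣ (p : ℤ) * 14 := by rw [mul_comm (p : ℤ) 14]; exact h14p
        exact (mul_dvd_mul_iff_left hp0).mp this
      have hd'e : e * d' = -28 * p := mul_left_cancel₀ hp0 (by linear_combination (-1 : ℤ) * hdd')
      have hele : e ≤ 14 := Int.le_of_dvd (by norm_num) he14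
      have hege : -14 ≤ e := by
        have := Int.le_of_dvd (by norm_num) ((Int.neg_dvd).mpr he14); linarith
      -- at `p` (type-α root tests `Q₁`, `Q₂`): `e = 1, -7`; at `2`: `e = 2, -14`
      have hne1 : e ≠ 1 := by
        rintro rfl
        refine not_isSoluble_padic_of_prime_dvd_coeffs_of_roots (p := p) (c := -84) (e := 1) (e' := -28) (by ring) (by ring)
          (show d' = (p : ℤ) * (-28) by linarith) hm28p (fun T hT ↦ ?_) (hpadic p)
        rintro ⟨X, rfl⟩
        apply (rootfree_seven_type_of_alpha hp8 hα X).1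
        have e1 : ((-28 : ℤ) : ZMod p) * (X * X) ^ 2 + ((-84 : ℤ) : ZMod p) * (X * X) + ((1 : ℤ) : ZMod p) =
            -(28 * X ^ 4 + 84 * X ^ 2 - 1) := by push_cast; ring
        rw [e1] at hT
        exact neg_eq_zero.mp hT
      have hne2 : e ≠ 2 := by
        rintro rfl
        exact not_isSoluble_two_dualPos_twoP_pOne (p := p) hp8 (by ring) (by ring) (show d' = -14 * (p : ℤ) by linarith) (hpadic 2)
      have hnem7 : e ≠ -7 := by
        rintro rfl
        refine not_isSoluble_padic_of_prime_dvd_coeffs_of_roots (p := p) (c := -84) (e := -7) (e' := 4) (by ring) (by ring)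
          (show d' = (p : ℤ) * 4 by linarith) h4p (fun T hT ↦ ?_) (hpadic p)
        rintro ⟨X, rfl⟩
        apply (rootfree_seven_type_of_alpha hp8 hα X).2.1
        have e1 : ((4 : ℤ) : ZMod p) * (X * X) ^ 2 + ((-84 : ℤ) : ZMod p) * (X * X) + ((-7 : ℤ) : ZMod p) =
            4 * X ^ 4 - 84 * X ^ 2 - 7 := by push_cast; ring
        rwa [e1] at hT
      have hnem14 : e ≠ -14 := by
        rintro rfl
        exact not_isSoluble_two_dualPos_negFourteenP_pOne (p := p) hp8 (by ring) (by ring) (show d' = 2 * (p : ℤ) by linarith) (hpadic 2)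
      -- at `7`: `e = -1, -2, 7, 14`
      have hnem1 : e ≠ -1 := by
        rintro rfl
        obtain ⟨r, hr⟩ := kill ((p : ℤ) * -1) d' (by linear_combination (p : ℤ) * hd'e)
          (by rw [mul_comm]; exact hnd7 (-1) (by decide) 1 ∘ (by intro h; simpa using h)) (hpadic 7)
        push_cast at hr
        exact (htab r).2.2.1 (by rw [← hr]; ring)
      have hnem2 : e ≠ -2 := by
        rintro rfl
        obtain ⟨r, hr⟩ := kill ((p : ℤ) * -2) d' (by linear_combination (p : ℤ) * hd'e)
          (by rw [mul_comm]; exact hnd7 (-2) (by decide) 1 ∘ (by intro h; simpa using h)) (hpadic 7)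
        push_cast at hr
        exact (htab r).2.2.2.1 (by rw [← hr]; ring)
      have hne7 : e ≠ 7 := by
        rintro rfl
        have hd'1 : d' = -4 * (p : ℤ) := by linarith
        obtain ⟨r, hr⟩ := kill' ((p : ℤ) * 7) d' (by linear_combination (p : ℤ) * hd'e)
          (by rw [hd'1]; exact hnd7 (-4) (by decide) 1 ∘ (by intro h; simpa using h)) (hpadic 7)
        rw [hd'1] at hr; push_cast at hr
        exact (htab r).2.2.2.2.1 (by rw [← hr])
      have hne14 : e ≠ 14 := by
        rintro rfl
        have hd'1 : d' = -2 * (p : ℤ) := by linarith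
        obtain ⟨r, hr⟩ := kill' ((p : ℤ) * 14) d' (by linear_combination (p : ℤ) * hd'e)
          (by rw [hd'1]; exact hnd7 (-2) (by decide) 1 ∘ (by intro h; simpa using h)) (hpadic 7)
        rw [hd'1] at hr; push_cast at hr
        exact (htab r).2.2.2.1 (by rw [← hr])
      exfalso
      obtain ⟨k, hk⟩ := he14
      interval_cases e <;> omega
    · have hcop : IsCoprime d (p : ℤ) := ((hpp.irreducible.coprime_iff_not_dvd).mpr hpd).symm
      have hd14 : d ∣ 14 := hcop.dvd_of_dvd_mul_right h14p
      have hle : d ≤ 14 := Int.le_of_dvd (by norm_num) hd14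
      have hge : -14 ≤ d := by
        have := Int.le_of_dvd (by norm_num) ((Int.neg_dvd).mpr hd14); linarith
      have hnm1 : d ≠ -1 := by
        rintro rfl
        obtain ⟨r, hr⟩ := kill (-1) d' hdd'.symm (by decide) (hpadic 7)
        push_cast at hr
        exact (htab r).1 hr.symm
      have hnm2 : d ≠ -2 := by
        rintro rfl
        obtain ⟨r, hr⟩ := kill (-2) d' hdd'.symm (by decide) (hpadic 7)
        push_cast at hr
        exact (htab r).2.1 hr.symm
      have hn7 : d ≠ 7 := by
        rintro rfl
        have hd'1 : d' = -4 * (p : ℤ) ^ 2 := by linarith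
        obtain ⟨r, hr⟩ := kill' 7 d' hdd'.symm (by rw [hd'1]; exact hnd7 (-4) (by decide) 2) (hpadic 7)
        rw [hd'1] at hr; push_cast at hr
        exact (htab r).2.2.2.2.2.1 hr.symm
      have hn14 : d ≠ 14 := by
        rintro rfl
        have hd'1 : d' = -2 * (p : ℤ) ^ 2 := by linarith
        obtain ⟨r, hr⟩ := kill' 14 d' hdd'.symm (by rw [hd'1]; exact hnd7 (-2) (by decide) 2) (hpadic 7)
        rw [hd'1] at hr; push_cast at hr
        exact (htab r).2.2.2.2.2.2 hr.symm
      -- at `2`: `2` and `-14` (D0-(L2))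
      have hn2 : d ≠ 2 := by
        rintro rfl
        exact not_isSoluble_two_dualPos_two_pOne (p := p) hp8 (by ring) rfl (show d' = -14 * (p : ℤ) ^ 2 by linarith) (hpadic 2)
      have hnm14 : d ≠ -14 := by
        rintro rfl
        exact not_isSoluble_two_dualPos_negFourteen_pOne (p := p) hp8 (by ring) rfl (show d' = 2 * (p : ℤ) ^ 2 by linarith) (hpadic 2)
      obtain ⟨k, hk⟩ := hd14
      interval_cases d <;> first | (exfalso; omega) | simp
  exact (Finset.card_le_card hsub).trans Finset.card_le_two

/-! ## §3. Consequences: rank `0`, `Ш[2] = 0`, `corank₂ Sel_{2^∞} = 0` for every model of `49a1^{(2p)}` -/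

/-- **`rank E_{2p}(ℚ) = 0` and `Ш(E_{2p})[2] = 0`** (UNCONDITIONAL) for the two-torsion model
`E_{2p} = [0, 21·(2p), 0, 112·(2p)², 0]`, type-α `p ≡ 1 (mod 8)` prime with `(−7/p) = +1` (`#S·#S' ≤ 4`).
[cite: SilvermanAEC2009, Thm. X.4.2(a) and Prop. X.4.9] -/
theorem rank_eq_zero_and_sha_two_twoTorsionModel_twoPosTwist_pOneAlpha {p : ℕ} [Fact p.Prime] (hp8 : p % 8 = 1)
    (hp7 : legendreSym p (-7) = 1) (hα : ¬ ∃ x : ZMod p, x ^ 4 = -7)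
    [hE : (⟨0, ((21 * (2 * (p : ℤ)) : ℤ) : ℚ), 0, ((112 * (2 * (p : ℤ)) ^ 2 : ℤ) : ℚ), 0⟩ : WeierstrassCurve ℚ).IsElliptic] :
    (⟨0, ((21 * (2 * (p : ℤ)) : ℤ) : ℚ), 0, ((112 * (2 * (p : ℤ)) ^ 2 : ℤ) : ℚ), 0⟩ : WeierstrassCurve ℚ).mordellWeilRank = 0 ∧
      ∀ c ∈ (⟨0, ((21 * (2 * (p : ℤ)) : ℤ) : ℚ), 0, ((112 * (2 * (p : ℤ)) ^ 2 : ℤ) : ℚ), 0⟩ : WeierstrassCurve ℚ).sha,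
        2 • c = 0 → c = 0 := by
  have hp : p.Prime := Fact.out
  have hab := hab_posTwist (M := (2 * (p : ℤ))) (mul_ne_zero two_ne_zero (by exact_mod_cast hp.ne_zero))
  haveI := isElliptic_halfModel hab
  have h42 : (21 * (2 * (p : ℤ))) = 42 * p := by ring
  have h448 : (112 * (2 * (p : ℤ)) ^ 2) = 448 * p ^ 2 := by ring
  refine rank_eq_zero_and_sha_two_of_card_le_two hab ?_ ?_
  · rw [h42, h448]; exact card_twoIsogenySelmerGroup_twoPosTwist_le_pOneAlpha hp8 hp7 hα
  · rw [h42, h448]; exact card_twoIsogenySelmerGroup'_twoPosTwist_le_pOneAlpha hp8 hp7 hα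

/-- **UNCONDITIONAL: `rank W(ℚ) = 0` and `Ш(W/ℚ)[2] = 0` for EVERY model `W` of `49a1^{(2p)}`**, type-α `p ≡ 1 (mod 8)` prime
with `(−7/p) = +1`. [cite: SilvermanAEC2009, Thm. X.4.2(a), Prop. X.4.9, III.3.1(b)] -/
theorem rank_eq_zero_and_sha_two_twoPosTwist_pOneAlpha {p : ℕ} [Fact p.Prime] (hp8 : p % 8 = 1)
    (hp7 : legendreSym p (-7) = 1) (hα : ¬ ∃ x : ZMod p, x ^ 4 = -7) (W : WeierstrassCurve ℚ) [W.IsElliptic] (C : VariableChange ℚ)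
    (hC : C • W = cm7.quadraticTwist ((2 * (p : ℤ) : ℤ) : ℚ)) :
    W.mordellWeilRank = 0 ∧ ∀ c ∈ W.sha, 2 • c = 0 → c = 0 := by
  have hp : p.Prime := Fact.out
  haveI := isElliptic_mk_of_ne_zero (F := ℚ)
    (hab_posTwist (M := (2 * (p : ℤ))) (mul_ne_zero two_ne_zero (by exact_mod_cast hp.ne_zero)))
  have hE := smul_eq_twoTorsionModel_of_smul_eq_quadraticTwist (2 * (p : ℤ)) W C hC
  exact rank_eq_zero_and_sha_two_of_smul_eq W _ _ hE
    (rank_eq_zero_and_sha_two_twoTorsionModel_twoPosTwist_pOneAlpha hp8 hp7 hα)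

/-- **`corank_{ℤ₂} Sel_{2^∞}(W/ℚ) = 0` for every model `W` of `49a1^{(2p)}`**, type-α `p ≡ 1 (mod 8)` prime, `(−7/p) = +1`
(Greenberg's identity `corank Sel = rank + corank Ш[2^∞]`, tree `selmerCorank_eq_mordellWeilRank_add_holds`) — the
hypothesis of Burungale–Tian's rank-zero `2`-converse, discharged unconditionally. [cite: Greenberg1999, §1]
[cite: SilvermanAEC2009, Thm. X.4.2(a) and Prop. X.4.9] -/
theorem selmerCorank_two_eq_zero_twoPosTwist_pOneAlpha {p : ℕ} [Fact p.Prime] (hp8 : p % 8 = 1)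
    (hp7 : legendreSym p (-7) = 1) (hα : ¬ ∃ x : ZMod p, x ^ 4 = -7) (W : WeierstrassCurve ℚ) [W.IsElliptic] (C : VariableChange ℚ)
    (hC : C • W = cm7.quadraticTwist ((2 * (p : ℤ) : ℤ) : ℚ)) : W.selmerCorank 2 = 0 := by
  haveI : Fact (Nat.Prime 2) := ⟨Nat.prime_two⟩
  obtain ⟨hr, hsha⟩ := rank_eq_zero_and_sha_two_twoPosTwist_pOneAlpha hp8 hp7 hα W C hC
  rw [W.selmerCorank_eq_mordellWeilRank_add_holds 2, hr, W.shaCorank_eq_zero_of_forall 2 hsha]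

end Summit.BirchSwinnertonDyer.BirchSwinnertonDyer.Theorems.GoldfeldGoodTwists
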